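import Literature.Analysis.FluidPDE.PassiveScalarProofs
import Literature.Analysis.FluidPDE.PassiveScalarClassicalEnergy
import Literature.Analysis.FunctionSpaces.TorusConvolution
import Literature.Analysis.FunctionSpaces.TorusMollifier
import Literature.Analysis.FunctionSpaces.TorusFluidGlueProofs
import Literature.Analysis.FunctionSpaces.TorusMaximalLipschitz
import Mathlib.MeasureTheory.Function.L2Space
import Mathlib.Analysis.InnerProductSpace.Continuous

/-!
# Steady renormalisation (DiPerna–Lions) for the condensate theorem

Stub `stub_condensateRenormalisation` of the condensate theorem (crux `TwohalfdNeg`, line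
`log-kantorovich-enstrophy-transfer`): if `Θ ∈ L²(T²)` solves the steady transport equation
`div(Θ V) = h` in distributions, `∫ Θ ⟪V, ∇φ⟫ + ∫ h φ = 0` for every smooth `φ`, with `V` smooth and
divergence free and `h` smooth, then `∫ Θ h = 0`.

Proof (DiPerna–Lions 1989, §II.1, Lemma II.1 and Thm. II.2, in the smooth-field `L²` setting of the
tree's commutator lemma `Literature.Analysis.FluidPDE.Torus.tendsto_eLpNorm_comm`): mollify with the
torus kernels `kₙ = Torus.kernel εₙ`, `εₙ → 0`. Testing the equation with the reflected kernel
`kₙ(x - ·)` gives the regularised equation `⟪V, ∇(Θ ⋆ kₙ)⟫ = rₙ + h ⋆ kₙ` with the commutator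
`rₙ(x) = ∫ Θ(y) ⟪V x - V y, ∇kₙ(x - y)⟫ dy`; multiplying by `Θ ⋆ kₙ` and using weak incompressibility
(`∫ A ⟪V, ∇A⟫ = 0`) yields `∫ (Θ ⋆ kₙ)(h ⋆ kₙ) = -∫ (Θ ⋆ kₙ) rₙ`. As `n → ∞`, `Θ ⋆ kₙ → Θ`,
`h ⋆ kₙ → h` and `rₙ → 0` in `L²(T²)`, so the left side tends to `∫ Θ h` and the right side to `0`
(continuity of the `L²` inner product).

## References

* R. J. DiPerna, P.-L. Lions, *Ordinary differential equations, transport theory and Sobolev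
  spaces*, Invent. Math. 98 (1989), 511–547, §II.1, Lemma II.1, Thm. II.2.
* L. Ambrosio, G. Crippa, *Continuity equations and ODE flows with non-smooth velocity*,
  Proc. Roy. Soc. Edinburgh 144A (2014), 1191–1244, §4, Thm. 4.6.
-/

namespace Summit.AnomalousDissipation.AnomalousDissipation.Theorems.TwohalfdNeg.Condensate

open MeasureTheory Filter Topology
open scoped ENNReal NNReal InnerProductSpace
open Literature.Analysis.FunctionSpaces Literature.Analysis.FluidPDE

set_option linter.dupNamespace false

open scoped Convolution

/-! ## Smooth vector fields on the torus are Lipschitz -/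

/-- A smooth vector field on the flat torus `T^d` is Lipschitz for the quotient (sup) metric of
`T^d = (ℝ/ℤ)^d`: the periodic lift has bounded derivative, hence is Lipschitz on `ℝ^d` (mean value
inequality, `Torus.fderiv_lift`), and two points `x, y ∈ T^d` have lifts at Euclidean distance
`≤ √d · dist x y` (the centred representative of `x - y`, `Torus.norm_reprc_le_sqrt_card_mul_norm`).
Vector-valued, general-`d` form of the scalar `T³` argument of
`Summit.AtomisticToContinuum.HydrodynamicLimit.Theorems.LocalSecondLawLedger.L.exists_lipschitzWith_of_isContDiff`
(another summit, not importable here). [folklore] -/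
theorem exists_lipschitzWith_of_isSmooth {d : Type*} [Fintype d]
    {V : UnitAddTorus d → EuclideanSpace ℝ d} (hV : Torus.IsSmooth V) :
    ∃ L : ℝ≥0, LipschitzWith L V := by
  have hV1 : Torus.IsContDiff 1 V := hV.isContDiff (by simp)
  obtain ⟨M, hM⟩ := Torus.exists_forall_norm_le_of_continuous hV1.continuous_fderiv
  have hlift : LipschitzWith (Real.toNNReal M) (Torus.lift V) := by
    refine lipschitzWith_of_nnnorm_fderiv_le (hV1.differentiable one_ne_zero) fun y => ?_
    rw [Torus.fderiv_lift, ← NNReal.coe_le_coe, coe_nnnorm]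
    exact (hM _).trans (Real.le_coe_toNNReal M)
  refine ⟨Real.toNNReal M * Real.toNNReal (Real.sqrt (Fintype.card d)),
    LipschitzWith.of_dist_le_mul fun x y => ?_⟩
  have hxy : Torus.proj (Torus.reprc y + Torus.reprc (x - y)) = x := by
    rw [Torus.proj_add, Torus.proj_reprc, Torus.proj_reprc, add_sub_cancel]
  have h1 := hlift.dist_le_mul (Torus.reprc y + Torus.reprc (x - y)) (Torus.reprc y)
  rw [Torus.lift_apply, Torus.lift_apply, hxy, Torus.proj_reprc, dist_eq_norm (Torus.reprc y + _),
    add_sub_cancel_left] at h1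
  have h2 : ‖Torus.reprc (x - y)‖ ≤ Real.sqrt (Fintype.card d) * dist x y := by
    rw [dist_eq_norm]
    exact Torus.norm_reprc_le_sqrt_card_mul_norm _
  calc dist (V x) (V y) ≤ Real.toNNReal M * ‖Torus.reprc (x - y)‖ := h1
    _ ≤ Real.toNNReal M * (Real.sqrt (Fintype.card d) * dist x y) :=
        mul_le_mul_of_nonneg_left h2 (NNReal.coe_nonneg _)
    _ = ((Real.toNNReal M * Real.toNNReal (Real.sqrt (Fintype.card d)) : ℝ≥0) : ℝ) * dist x y := by
        rw [NNReal.coe_mul, Real.coe_toNNReal _ (Real.sqrt_nonneg _)]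
        ring

/-! ## The regularised steady transport equation -/

section Regularised

variable {d : Type*} [Fintype d] {V : UnitAddTorus d → EuclideanSpace ℝ d}
  {h Θ k : UnitAddTorus d → ℝ}

/-- **Regularised steady transport equation with commutator.** If `Θ ∈ L¹` solves
`div(Θ V) = h` in distributions, then for every smooth kernel `k`,
`⟪V x, ∇(Θ ⋆ k)(x)⟫ = r(x) + (h ⋆ k)(x)` with the commutator
`r(x) = ∫ Θ(y) ⟪V x - V y, ∇k(x - y)⟫ dy` (test the equation with `k(x - ·)`; DiPerna–Lions 1989,
§II.1, the regularised equation). [folklore] -/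
theorem inner_gradient_convolution_eq (hVc : Continuous V) (hΘ : Integrable Θ volume)
    (hk : Torus.IsSmooth k)
    (hdist : ∀ φ : UnitAddTorus d → ℝ, Torus.IsSmooth φ →
      (∫ x, Θ x * ⟪V x, Torus.gradient φ x⟫_ℝ) + ∫ x, h x * φ x = 0)
    (x : UnitAddTorus d) :
    ⟪V x, Torus.gradient (Θ ⋆ k) x⟫_ℝ =
      (∫ y, Θ y * ⟪V x - V y, Torus.gradient k (x - y)⟫_ℝ) + (h ⋆ k) x := by
  have hf := Literature.Analysis.FluidPDE.Torus.fluxIntegral_eq_comm_sub_add hΘ hVc hk 0 x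
  simp only [zero_mul, add_zero] at hf
  have hx : (∫ y, Θ y * ⟪V y, Torus.gradient (fun z => k (x - z)) y⟫_ℝ) +
      ∫ y, h y * k (x - y) = 0 := hdist _ (hk.comp_sub_left x)
  simp only [Torus.gradient_comp_sub_left k x, inner_neg_right] at hx
  rw [hf] at hx
  have hH : (h ⋆ k) x = ∫ y, h y * k (x - y) := by
    simp only [convolution_lsmul, smul_eq_mul]
  rw [hH]
  linarith

/-- **Energy identity for the regularised equation.** Under the hypotheses of
`inner_gradient_convolution_eq`, with `V` weakly divergence free and `h ∈ L¹`:
`∫ (Θ ⋆ k)(h ⋆ k) = -∫ (Θ ⋆ k) r` (multiply the regularised equation by `A = Θ ⋆ k` and use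
`∫ A ⟪V, ∇A⟫ = 0`; DiPerna–Lions 1989, proof of Thm. II.2). [folklore] -/
theorem integral_convolution_mul_convolution_eq_neg (hVc : Continuous V)
    (hdiv : Torus.IsWeaklyDivFree V) (hΘ : Integrable Θ volume) (hh : Integrable h volume)
    (hk : Torus.IsSmooth k)
    (hdist : ∀ φ : UnitAddTorus d → ℝ, Torus.IsSmooth φ →
      (∫ x, Θ x * ⟪V x, Torus.gradient φ x⟫_ℝ) + ∫ x, h x * φ x = 0) :
    ∫ x, (Θ ⋆ k) x * (h ⋆ k) x =
      -∫ x, (Θ ⋆ k) x * ∫ y, Θ y * ⟪V x - V y, Torus.gradient k (x - y)⟫_ℝ := by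
  have hA : Torus.IsSmooth (Θ ⋆ k) := Torus.isSmooth_convolution hΘ hk
  have h0 := Literature.Analysis.FluidPDE.Torus.integral_mul_inner_gradient_eq_zero (v := V) hA hdiv
  simp_rw [inner_gradient_convolution_eq hVc hΘ hk hdist] at h0
  have hrc : Continuous fun x => ∫ y, Θ y * ⟪V x - V y, Torus.gradient k (x - y)⟫_ℝ :=
    Literature.Analysis.FluidPDE.Torus.continuous_comm hΘ hVc hk
  have hHc : Continuous (h ⋆ k) := Torus.continuous_convolution hh hk.continuous
  have i1 : Integrable (fun x => (Θ ⋆ k) x *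
      ∫ y, Θ y * ⟪V x - V y, Torus.gradient k (x - y)⟫_ℝ) volume :=
    (hA.continuous.mul hrc).integrable_unitAddTorus
  have i2 : Integrable (fun x => (Θ ⋆ k) x * (h ⋆ k) x) volume :=
    (hA.continuous.mul hHc).integrable_unitAddTorus
  simp_rw [mul_add] at h0
  rw [integral_add i1 i2] at h0
  linarith

end Regularised

/-! ## The `L²` limit -/

section Limit

variable {X : Type*} [MeasurableSpace X] {μ : Measure X}

/-- **Abstract limit step.** If `∫ Aₙ Hₙ = -∫ Aₙ rₙ` for all `n`, with `Aₙ → Θ`, `Hₙ → h` and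
`rₙ → 0` in `L²`, then `∫ Θ h = 0` (continuity of the `L²` inner product, `⟪[f], [g]⟫ = ∫ f g` —
cf. the tree's `Literature.Probability.LatticeModels.inner_toLp_eq_integral`, re-derived inline to
keep the Markov-chain library out of the imports — and uniqueness of limits). [folklore] -/
theorem integral_mul_eq_zero_of_tendsto {Θ h : X → ℝ} {A H r : ℕ → X → ℝ}
    (hΘ : MemLp Θ 2 μ) (hh : MemLp h 2 μ) (hA : ∀ n, MemLp (A n) 2 μ)
    (hH : ∀ n, MemLp (H n) 2 μ) (hr : ∀ n, MemLp (r n) 2 μ)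
    (hid : ∀ n, ∫ x, A n x * H n x ∂μ = -∫ x, A n x * r n x ∂μ)
    (hAconv : Tendsto (fun n => eLpNorm (A n - Θ) 2 μ) atTop (𝓝 0))
    (hHconv : Tendsto (fun n => eLpNorm (H n - h) 2 μ) atTop (𝓝 0))
    (hrconv : Tendsto (fun n => eLpNorm (r n) 2 μ) atTop (𝓝 0)) :
    ∫ x, Θ x * h x ∂μ = 0 := by
  -- `⟪[f], [g]⟫_{L²} = ∫ f g`
  have inner_toLp_eq_integral : ∀ {f g : X → ℝ} (hf : MemLp f 2 μ) (hg : MemLp g 2 μ),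
      ⟪hf.toLp f, hg.toLp g⟫_ℝ = ∫ x, f x * g x ∂μ := by
    intro f g hf hg
    rw [MeasureTheory.L2.inner_def]
    refine integral_congr_ae ?_
    filter_upwards [hf.coeFn_toLp, hg.coeFn_toLp] with x hfx hgx
    rw [hfx, hgx, RCLike.inner_apply, conj_trivial, mul_comm]
  have h0 : MemLp (0 : X → ℝ) 2 μ := MemLp.zero
  have tA : Tendsto (fun n => (hA n).toLp (A n)) atTop (𝓝 (hΘ.toLp Θ)) :=
    (Lp.tendsto_Lp_iff_tendsto_eLpNorm'' _ hA _ hΘ).2 hAconv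
  have tH : Tendsto (fun n => (hH n).toLp (H n)) atTop (𝓝 (hh.toLp h)) :=
    (Lp.tendsto_Lp_iff_tendsto_eLpNorm'' _ hH _ hh).2 hHconv
  have tr : Tendsto (fun n => (hr n).toLp (r n)) atTop (𝓝 (h0.toLp 0)) := by
    refine (Lp.tendsto_Lp_iff_tendsto_eLpNorm'' _ hr _ h0).2 ?_
    simpa only [sub_zero] using hrconv
  have lim1 : Tendsto (fun n => ∫ x, A n x * H n x ∂μ) atTop (𝓝 (∫ x, Θ x * h x ∂μ)) := by
    have := tA.inner (𝕜 := ℝ) tH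
    simpa only [inner_toLp_eq_integral] using this
  have lim2 : Tendsto (fun n => ∫ x, A n x * H n x ∂μ) atTop (𝓝 0) := by
    have := (tA.inner (𝕜 := ℝ) tr).neg
    simp only [inner_toLp_eq_integral, Pi.zero_apply, mul_zero, integral_zero, neg_zero] at this
    refine this.congr fun n => ?_
    rw [hid n]
  exact tendsto_nhds_unique lim1 lim2

end Limit

/-! ## The stub -/

/-- **Stub G — steady renormalisation (DiPerna–Lions).** If `Θ ∈ L²(T²)` solves `div(Θ V) = h`
in distributions for a smooth divergence-free `V` and a smooth `h`, then `∫ Θ h = 0`: mollify,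
`V·∇Θ_ε = h ⋆ k_ε + r_ε` with the commutator `r_ε → 0` in `L²` (`Torus.tendsto_eLpNorm_comm`),
and `∫ (V·∇Θ_ε) Θ_ε = 0`. [cite: DiPernaLions1989Invent, §II.1, Lemma II.1 and Thm. II.2] -/
theorem stub_condensateRenormalisation :
    ∀ (V : UnitAddTorus (Fin 2) → EuclideanSpace ℝ (Fin 2)) (h Θ : UnitAddTorus (Fin 2) → ℝ),
      Torus.IsSmooth V → Torus.IsDivFree V → Torus.IsSmooth h → MemLp Θ 2 volume →
      (∀ φ : UnitAddTorus (Fin 2) → ℝ, Torus.IsSmooth φ →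
        (∫ x, Θ x * inner ℝ (V x) (Torus.gradient φ x)) + ∫ x, h x * φ x = 0) →
      ∫ x, Θ x * h x = 0 := by
  intro V h Θ hV hVdiv hh hΘ hdist
  obtain ⟨L, hL⟩ := exists_lipschitzWith_of_isSmooth hV
  have hVc : Continuous V := hV.continuous
  have hWdiv : Torus.IsWeaklyDivFree V := Torus.IsDivFree.isWeaklyDivFree_holds hV hVdiv
  have hΘi : Integrable Θ volume := hΘ.integrable one_le_two
  have hhi : Integrable h volume := hh.integrable
  obtain ⟨hε, hε', hε0⟩ := Literature.Analysis.FluidPDE.Torus.molRadius_spec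
  have hkS : ∀ n : ℕ, Torus.IsSmooth (Torus.kernel (d := Fin 2) (1 / (4 * ((n : ℝ) + 1)))) :=
    fun n => Torus.isSmooth_kernel (hε n) (hε' n)
  refine integral_mul_eq_zero_of_tendsto (μ := volume)
    (A := fun n => Θ ⋆ Torus.kernel (1 / (4 * ((n : ℝ) + 1))))
    (H := fun n => h ⋆ Torus.kernel (1 / (4 * ((n : ℝ) + 1))))
    (r := fun n x => ∫ y, Θ y * ⟪V x - V y,
      Torus.gradient (Torus.kernel (1 / (4 * ((n : ℝ) + 1)))) (x - y)⟫_ℝ)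
    hΘ (hh.memLp 2) (fun n => (Torus.isSmooth_convolution hΘi (hkS n)).memLp 2)
    (fun n => (Torus.isSmooth_convolution hhi (hkS n)).memLp 2)
    (fun n => (Literature.Analysis.FluidPDE.Torus.continuous_comm hΘi hVc
      (hkS n)).memLp_of_hasCompactSupport (HasCompactSupport.of_compactSpace _))
    (fun n => integral_convolution_mul_convolution_eq_neg hVc hWdiv hΘi hhi (hkS n) hdist)
    ?_ ?_ ?_
  · exact Torus.tendsto_eLpNorm_convolution_sub_self hΘ
      (fun n y => Torus.kernel_nonneg (hε n).le y) (fun n => Torus.integral_kernel (hε n) (hε' n))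
      (fun n => Torus.support_kernel_subset (hε n))
      (fun n => Torus.continuous_kernel (hε n) (hε' n)) hε0
  · exact Torus.tendsto_eLpNorm_convolution_sub_self (hh.memLp 2)
      (fun n y => Torus.kernel_nonneg (hε n).le y) (fun n => Torus.integral_kernel (hε n) (hε' n))
      (fun n => Torus.support_kernel_subset (hε n))
      (fun n => Torus.continuous_kernel (hε n) (hε' n)) hε0
  · exact Literature.Analysis.FluidPDE.Torus.tendsto_eLpNorm_comm hL hWdiv hΘ hε hε' hε0

end Summit.AnomalousDissipation.AnomalousDissipation.Theorems.TwohalfdNeg.Condensate
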